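import Summits.CriticalPhenomena.PercolationContinuityZ3.Theorems.PercNearOneGluingNoHeavyQuantLawDecFlows
import HarnessLib

/-!
# QUANT lane R8, SGC in the RELAY case: the second relay capacity inequality (L1) — the interior-mid inequality of the ONE-ROW PRINCIPLE
# for a factor low whose successor is still a product low

builds on p205010 (kernel theorem, internal audit signed; external expert review pending)

Support file (`--supports stmt-CriticalPhenomena-4575`), QUANT lane seat prim-quant-arm-2 (gen 39), rung R8 of
`run/shared/lean/prim/quant/LADDER.md`; memo `run/shared/lean/prim/quant/prim-quant-arm-2-g39/ONE-ROW-PRINCIPLE-G39.md` §3/§3b.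
Theorems only (no definitions), standard axioms, no sorries; imports `…QuantLawDecFlows` (typer g22: `LawDec.pairGate`).  Companion of census-2 g67's
`…QuantDepthTwoRelayCap` (inequality (B), `LawDec.relay_cap_core`).

THE CONTEXT.  In the relay case (factor `μ` on `{0..M}` at target `T`, partner `{0: 1−g, 1: g}` with `y ≤ g ≤ 1`, product at `T′ = T + g`) the
ONE-ROW PRINCIPLE (this seat; exact census ≈ 1.5 M instances, 0 violations) says that EVERY dual row of the product flow LP at a layer `j` — every
price system `(α′, β′)` of `LawDec.FlowAtT y T′ j (M+1) ν`, all depths — pulled back along the relay (`e(a) = (1−g)C′(a) + g·C′(a+1)`) is dominated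
coefficientwise by ONE factor price system at layer `j* ∈ {j−1, j}` (prices `e⁺`, charges `−e`), so that DEC itself passes from `μ` (layers `j−1`, `j`)
to the relay product (layer `j`) by the tree's duality pair (`dual_le_of_decAtT`, `flowAtT_of_prices`).  Per valid factor pair `(l, a)` the domination
is ONE real inequality between capacities `ψ(ρ) = 1/pairGate − 1` (`ρ = (target − 2·low)/(high − low)`): for a factor low `l` whose successor `l + 1`
is NOT a product low it is inequality (B) of census-2 g67 (✓ `relay_cap_core`); for a factor low whose successor IS a product low (`σ := s + g > 2`,
`s = T − 2l`, `n = a − l > s`) the product prices `α′(l) ≥ α′(l+1) = x·α′(l)` pull back to `α′(l)((1−g) + gx)` and, minimising over the ratio `x`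
(kink at `x = R/S`), the domination on the mid `a` is

  **(L1)**  `(1−g)·(P − Q)·S ≤ g·R·(S − P)`,   `P = ψ(s/n)`, `Q = ψ(σ/n)`, `R = ψ(σ/(n+1))`, `S = ψ((σ−2)/n)`

(`P` = factor capacity of `(l, a)` at `T`; `Q`, `R`, `S` = product capacities of `(l, a)`, `(l, a+1)`, `(l+1, a+1)` at `T + g`).  THIS FILE proves (L1)
for real parameters `0 < y < 1`, `y ≤ g ≤ 1`, `0 < s < n`, `s + g > 2`, in the equivalent cleared form (`relay_capL1_F`): with
`F(c) = max(c, y²n + (1−y)c)` (so that `1/pairGate` of the pair with `ρ = c/n` is `n/F(c)`) and `F′(c) = max(c, y²(n+1) + (1−y)c)`,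
`p = F(σ−2)`, `q = F(s)`, `r = F(σ)`, `r′ = F′(σ)`:

  `(1−g)·(r − q)·(n − p)·r′ ≤ g·(n + 1 − r′)·(q − p)·r`,

then in the `ψ`-form (`relay_capL1_core`, unclipped `Q`, which only strengthens it) and for `LawDec.pairGate` at the four pairs (`relay_capL1_pairGate`).
PROOF (memo §3b; identities machine-checked by exact evaluation, `code/l1_identities.py`): five regimes by the position of `yn` — (I) `yn ≤ σ−2`
(all minimal gates linear): margin `gσ(n − s)`; (II) `σ−2 < yn ≤ s`: margin `gσ(n−s)(1 − w)`, `w = y²n − y(σ−2) ≤ y(2−g) ≤ 1`; (IIIa) `s < yn`,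
`y(n+1) ≤ σ`: `y·margin = (1−y)σ[gs(1−2y+gy) + gδ(1−y+gy) + (1−g)y²δ(n+2−g+δ)]`, `δ = yn − s` (`1 − 2y + gy ≥ (1−y)²`); (IIIb) `yn ≤ σ < y(n+1)`:
`y·margin = (1−y)·G(δ)` with `G` increasing on `δ ≥ g − y` by an explicit three-term identity and `G(g−y) ≥ 0` the IIIa value; (IV) `yn > σ` (all light):
margin `g(1−y)²[X(r − (1−g)y²) + r(g(1−y)+2y) − 2(1−g)y²]`, `X = (1+y)n − σ`, `r = y²n + (1−y)σ ≥ 2y`.  Exact scan `code/ineq_L1.py` / `ineq_L1c.py`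
(25 872 rational points incl. `n ∈ (s, σ]`, worst margin `→ 0⁺` as `n → s⁺`).

HONEST STATUS: one real inequality; the one-row principle's remaining analytic inputs (the two top-atom endpoint forms, memo §3b TopL1-a/b) and its
bookkeeping are NOT in this file; SGC, D2, G₁ (general), `Quant.FarTreeRow` (light) remain OPEN; nothing here is cited as a published result; the lane's
RATE class log\* and honest sentence (`run/shared/lean/prim/quant/README.md`) are unchanged.

[this work]; inequality (B) and the capacity bookkeeping: prim-quant-census-2 g67; minimal gates: prim-quant-stmt g22 (this lane).  The gluing rows served
[cite: KozmaNitzan2024, Conjecture 3 (p. 15)]; product measure [cite: Grimmett1999, §1.3 p. 10].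
-/

noncomputable section

namespace Summit.CriticalPhenomena.PercolationContinuityZ3.Theorems

namespace Quant

namespace LawDec

/-! ### (L1) in the cleared `F`-form -/

set_option maxHeartbeats 400000 in
/-- **INEQUALITY (L1), cleared form** (real parameters).  `0 < y < 1`, `y ≤ g ≤ 1`, `0 < s < n`, `2 < s + g`; with `F(c) = max(c, y²n + (1−y)c)`,
`F′(c) = max(c, y²(n+1) + (1−y)c)`, `p = F(s+g−2)`, `q = F(s)`, `r = F(s+g)`, `r′ = F′(s+g)`:
`(1−g)(r − q)(n − p)·r′ ≤ g(n + 1 − r′)(q − p)·r`. [this work] -/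
theorem relay_capL1_F (y g s n : ℝ) (hy0 : 0 < y) (hy1 : y < 1) (hyg : y ≤ g) (hg1 : g ≤ 1)
    (hs : 0 < s) (hσ : 2 < s + g) (hsn : s < n) :
    (1 - g) * (max (s + g) (y ^ 2 * n + (1 - y) * (s + g)) - max s (y ^ 2 * n + (1 - y) * s))
        * (n - max (s + g - 2) (y ^ 2 * n + (1 - y) * (s + g - 2))) * max (s + g) (y ^ 2 * (n + 1) + (1 - y) * (s + g))
      ≤ g * (n + 1 - max (s + g) (y ^ 2 * (n + 1) + (1 - y) * (s + g)))
        * (max s (y ^ 2 * n + (1 - y) * s) - max (s + g - 2) (y ^ 2 * n + (1 - y) * (s + g - 2)))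
        * max (s + g) (y ^ 2 * n + (1 - y) * (s + g)) := by
  have h1y : 0 < 1 - y := by linarith
  have hg0 : 0 < g := lt_of_lt_of_le hy0 hyg
  have hn : 0 < n := lt_trans hs hsn
  have hσ0 : 0 < s + g := by linarith
  -- the two branches of `F`
  have hlin : ∀ c m : ℝ, y * m ≤ c → max c (y ^ 2 * m + (1 - y) * c) = c := by
    intro c m h
    refine max_eq_left ?_
    nlinarith [mul_le_mul_of_nonneg_left h hy0.le]
  have hlight : ∀ c m : ℝ, c ≤ y * m → max c (y ^ 2 * m + (1 - y) * c) = y ^ 2 * m + (1 - y) * c := by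
    intro c m h
    refine max_eq_right ?_
    nlinarith [mul_le_mul_of_nonneg_left h hy0.le]
  rcases le_or_gt (y * n) (s + g - 2) with h1 | h1
  · ---- (I) all minimal gates linear
    rw [hlin (s + g) n (by linarith), hlin s n (by linarith), hlin (s + g - 2) n h1,
      hlin (s + g) (n + 1) (by nlinarith)]
    nlinarith [mul_nonneg (mul_nonneg hg0.le hσ0.le) (sub_nonneg.2 hsn.le)]
  rcases le_or_gt (y * n) s with h2 | h2
  · ---- (II) `p` light, `q`, `r`, `r′` linear
    rw [hlin (s + g) n (by linarith), hlin s n h2, hlight (s + g - 2) n h1.le,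
      hlin (s + g) (n + 1) (by nlinarith)]
    have hw : 0 ≤ 1 - (y ^ 2 * n - y * (s + g - 2)) := by
      nlinarith [mul_le_mul_of_nonneg_left h2 hy0.le, mul_le_mul_of_nonneg_left hyg hy0.le]
    have key : g * (n + 1 - (s + g)) * (s - (y ^ 2 * n + (1 - y) * (s + g - 2))) * (s + g)
        - (1 - g) * ((s + g) - s) * (n - (y ^ 2 * n + (1 - y) * (s + g - 2))) * (s + g)
        = g * (s + g) * (n - s) * (1 - (y ^ 2 * n - y * (s + g - 2))) := by ring
    nlinarith [mul_nonneg (mul_nonneg (mul_nonneg hg0.le hσ0.le) (sub_nonneg.2 hsn.le)) hw, key]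
  rcases le_or_gt (s + g) (y * n) with h3 | h3
  · ---- (IV) all light (then also `s + g < y(n+1)`)
    rw [hlight (s + g) n h3, hlight s n h2.le, hlight (s + g - 2) n h1.le,
      hlight (s + g) (n + 1) (by nlinarith)]
    have hX : 0 ≤ (1 + y) * n - (s + g) := by nlinarith
    have hr1 : 0 ≤ y ^ 2 * n + (1 - y) * (s + g) - (1 - g) * y ^ 2 := by
      nlinarith [mul_nonneg (mul_nonneg hy0.le hy0.le) (by linarith : (0 : ℝ) ≤ n - 1)]
    have hr2 : 0 ≤ (y ^ 2 * n + (1 - y) * (s + g)) * (g * (1 - y) + 2 * y) - 2 * (1 - g) * y ^ 2 := by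
      have hr : 2 * y ≤ y ^ 2 * n + (1 - y) * (s + g) := by nlinarith [mul_le_mul_of_nonneg_left h3 hy0.le]
      nlinarith [mul_nonneg (sub_nonneg.2 hr) hy0.le, mul_nonneg (mul_nonneg hg0.le h1y.le) (by nlinarith : (0:ℝ) ≤ y ^ 2 * n + (1 - y) * (s + g)),
        mul_nonneg hg0.le (mul_nonneg hy0.le hy0.le)]
    have key : g * (n + 1 - (y ^ 2 * (n + 1) + (1 - y) * (s + g))) * ((y ^ 2 * n + (1 - y) * s) - (y ^ 2 * n + (1 - y) * (s + g - 2)))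
          * (y ^ 2 * n + (1 - y) * (s + g))
        - (1 - g) * ((y ^ 2 * n + (1 - y) * (s + g)) - (y ^ 2 * n + (1 - y) * s)) * (n - (y ^ 2 * n + (1 - y) * (s + g - 2)))
          * (y ^ 2 * (n + 1) + (1 - y) * (s + g))
        = g * (1 - y) ^ 2 * (((1 + y) * n - (s + g)) * (y ^ 2 * n + (1 - y) * (s + g) - (1 - g) * y ^ 2)
          + ((y ^ 2 * n + (1 - y) * (s + g)) * (g * (1 - y) + 2 * y) - 2 * (1 - g) * y ^ 2)) := by ring
    nlinarith [mul_nonneg (mul_nonneg hg0.le (mul_nonneg h1y.le h1y.le)) (add_nonneg (mul_nonneg hX hr1) hr2), key]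
  ---- (III) `p`, `q` light, `r` linear
  rcases le_or_gt (y * (n + 1)) (s + g) with h4 | h4
  · ---- (IIIa) `r′` linear
    rw [hlin (s + g) n h3.le, hlight s n h2.le, hlight (s + g - 2) n h1.le, hlin (s + g) (n + 1) h4]
    have hδ : 0 ≤ y * n - s := by linarith
    have hc1 : 0 ≤ 1 - 2 * y + g * y := by nlinarith [mul_le_mul_of_nonneg_left hyg hy0.le]
    have hsum : 0 ≤ g * s * (1 - 2 * y + g * y) + g * (y * n - s) * (1 - y + g * y)
        + (1 - g) * y ^ 2 * (y * n - s) * (n + 2 - g + (y * n - s)) := by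
      have t1 := mul_nonneg (mul_nonneg hg0.le hs.le) hc1
      have t2 := mul_nonneg (mul_nonneg hg0.le hδ) (by nlinarith : (0:ℝ) ≤ 1 - y + g * y)
      have t3 := mul_nonneg (mul_nonneg (mul_nonneg (sub_nonneg.2 hg1) (mul_nonneg hy0.le hy0.le)) hδ)
        (by linarith : (0:ℝ) ≤ n + 2 - g + (y * n - s))
      nlinarith [t1, t2, t3]
    have key : y * (g * (n + 1 - (s + g)) * ((y ^ 2 * n + (1 - y) * s) - (y ^ 2 * n + (1 - y) * (s + g - 2))) * (s + g)
        - (1 - g) * ((s + g) - (y ^ 2 * n + (1 - y) * s)) * (n - (y ^ 2 * n + (1 - y) * (s + g - 2))) * (s + g))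
        = (1 - y) * (s + g) * (g * s * (1 - 2 * y + g * y) + g * (y * n - s) * (1 - y + g * y)
          + (1 - g) * y ^ 2 * (y * n - s) * (n + 2 - g + (y * n - s))) := by ring
    have hpos : 0 ≤ y * (g * (n + 1 - (s + g)) * ((y ^ 2 * n + (1 - y) * s) - (y ^ 2 * n + (1 - y) * (s + g - 2))) * (s + g)
        - (1 - g) * ((s + g) - (y ^ 2 * n + (1 - y) * s)) * (n - (y ^ 2 * n + (1 - y) * (s + g - 2))) * (s + g)) := by
      rw [key]; exact mul_nonneg (mul_nonneg h1y.le hσ0.le) hsum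
    exact sub_nonneg.1 ((mul_nonneg_iff_of_pos_left hy0).1 hpos)
  · ---- (IIIb) `r′` light
    rw [hlin (s + g) n h3.le, hlight s n h2.le, hlight (s + g - 2) n h1.le, hlight (s + g) (n + 1) h4.le]
    -- δ := y n − s ∈ (g − y, g], δ₀ := g − y; K := s + y + y² − yg; Π(d) := (g − yd)(K + g − y + yd); B, G as in the module docstring
    have hδ0 : 0 ≤ (y * n - s) - (g - y) := by nlinarith
    have hK0 : 0 < (s + y + y ^ 2 - y * g) + (1 + y) * (g - y) := by nlinarith [mul_nonneg hy0.le hg0.le]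
    -- G(δ₀) is the IIIa margin at the boundary: explicitly nonnegative
    have eG0 : (((s + y + y ^ 2 - y * g) + (1 + y) * (g - y)) * (g * (1 - y) * (2 - g) * (s + g) - (1 - g) * ((g - y * (g - y)) * (((s + y + y ^ 2 - y * g) + g - y) + y * (g - y)))) - (1 - g) * ((g - y * (g - y)) * (((s + y + y ^ 2 - y * g) + g - y) + y * (g - y))) * y * (1 - y))
        = ((s + g) * (g * s * (1 - 2 * y + g * y) + g * (g - y) * (1 - y + g * y) + (1 - g) * (y * (g - y) * (s + (g - y)) + y ^ 2 * (g - y) * (2 - g + (g - y))))) := by ring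
    have hc1 : 0 ≤ 1 - 2 * y + g * y := by nlinarith [mul_le_mul_of_nonneg_left hyg hy0.le]
    have hd00 : 0 ≤ (g - y) := by linarith
    have hG0 : 0 ≤ (((s + y + y ^ 2 - y * g) + (1 + y) * (g - y)) * (g * (1 - y) * (2 - g) * (s + g) - (1 - g) * ((g - y * (g - y)) * (((s + y + y ^ 2 - y * g) + g - y) + y * (g - y)))) - (1 - g) * ((g - y * (g - y)) * (((s + y + y ^ 2 - y * g) + g - y) + y * (g - y))) * y * (1 - y)) := by
      rw [eG0]
      have t1 := mul_nonneg (mul_nonneg hg0.le hs.le) hc1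
      have t2 := mul_nonneg (mul_nonneg hg0.le hd00) (by nlinarith : (0:ℝ) ≤ 1 - y + g * y)
      have t3 := mul_nonneg (mul_nonneg hy0.le hd00) (by linarith : (0:ℝ) ≤ s + (g - y))
      have t4 := mul_nonneg (mul_nonneg (mul_nonneg hy0.le hy0.le) hd00) (by linarith : (0:ℝ) ≤ 2 - g + (g - y))
      have t5 := mul_nonneg (sub_nonneg.2 hg1) (add_nonneg t3 t4)
      exact mul_nonneg hσ0.le (by nlinarith [t1, t2, t5])
    -- Π(δ₀) ≥ 0 and hence B(δ₀) ≥ 0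
    have hPi0 : 0 ≤ ((g - y * (g - y)) * (((s + y + y ^ 2 - y * g) + g - y) + y * (g - y))) := by
      have a1 : 0 ≤ g - y * (g - y) := by nlinarith [mul_nonneg hy0.le hy0.le]
      have a2 : 0 ≤ ((s + y + y ^ 2 - y * g) + g - y) + y * (g - y) := by nlinarith
      exact mul_nonneg a1 a2
    have eGB : (((s + y + y ^ 2 - y * g) + (1 + y) * (g - y)) * (g * (1 - y) * (2 - g) * (s + g) - (1 - g) * ((g - y * (g - y)) * (((s + y + y ^ 2 - y * g) + g - y) + y * (g - y)))) - (1 - g) * ((g - y * (g - y)) * (((s + y + y ^ 2 - y * g) + g - y) + y * (g - y))) * y * (1 - y)) + (1 - g) * ((g - y * (g - y)) * (((s + y + y ^ 2 - y * g) + g - y) + y * (g - y))) * y * (1 - y)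
        = ((s + y + y ^ 2 - y * g) + (1 + y) * (g - y)) * (g * (1 - y) * (2 - g) * (s + g) - (1 - g) * ((g - y * (g - y)) * (((s + y + y ^ 2 - y * g) + g - y) + y * (g - y)))) := by ring
    have hB0 : 0 ≤ (g * (1 - y) * (2 - g) * (s + g) - (1 - g) * ((g - y * (g - y)) * (((s + y + y ^ 2 - y * g) + g - y) + y * (g - y)))) := by
      have hprod : 0 ≤ ((s + y + y ^ 2 - y * g) + (1 + y) * (g - y)) * (g * (1 - y) * (2 - g) * (s + g) - (1 - g) * ((g - y * (g - y)) * (((s + y + y ^ 2 - y * g) + g - y) + y * (g - y)))) := by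
        rw [← eGB]
        have := mul_nonneg (mul_nonneg (mul_nonneg (sub_nonneg.2 hg1) hPi0) hy0.le) h1y.le
        linarith
      exact (mul_nonneg_iff_of_pos_right hK0).1 (by linarith [hprod] : 0 ≤ (g * (1 - y) * (2 - g) * (s + g) - (1 - g) * ((g - y * (g - y)) * (((s + y + y ^ 2 - y * g) + g - y) + y * (g - y)))) * ((s + y + y ^ 2 - y * g) + (1 + y) * (g - y)))
    -- Π decreases from δ₀ to δ
    have ePi : ((g - y * (g - y)) * (((s + y + y ^ 2 - y * g) + g - y) + y * (g - y))) - ((g - y * (y * n - s)) * (((s + y + y ^ 2 - y * g) + g - y) + y * (y * n - s))) = ((y * n - s) - (g - y)) * y * (((s + y + y ^ 2 - y * g) + g - y) - g + y * ((y * n - s) + (g - y))) := by ring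
    have hPi : 0 ≤ ((g - y * (g - y)) * (((s + y + y ^ 2 - y * g) + g - y) + y * (g - y))) - ((g - y * (y * n - s)) * (((s + y + y ^ 2 - y * g) + g - y) + y * (y * n - s))) := by
      rw [ePi]
      exact mul_nonneg (mul_nonneg hδ0 hy0.le)
        (by linarith only [mul_nonneg hs.le h1y.le, mul_nonneg (mul_nonneg hy0.le hy0.le) hn.le, hδ0, hd00])
    -- the three-term monotonicity identity
    have emono : (((s + y + y ^ 2 - y * g) + (1 + y) * (y * n - s)) * (g * (1 - y) * (2 - g) * (s + g) - (1 - g) * ((g - y * (y * n - s)) * (((s + y + y ^ 2 - y * g) + g - y) + y * (y * n - s)))) - (1 - g) * ((g - y * (y * n - s)) * (((s + y + y ^ 2 - y * g) + g - y) + y * (y * n - s))) * y * (1 - y)) - (((s + y + y ^ 2 - y * g) + (1 + y) * (g - y)) * (g * (1 - y) * (2 - g) * (s + g) - (1 - g) * ((g - y * (g - y)) * (((s + y + y ^ 2 - y * g) + g - y) + y * (g - y)))) - (1 - g) * ((g - y * (g - y)) * (((s + y + y ^ 2 - y * g) + g - y) + y * (g - y))) * y * (1 - y))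
        = (1 + y) * ((y * n - s) - (g - y)) * (g * (1 - y) * (2 - g) * (s + g) - (1 - g) * ((g - y * (g - y)) * (((s + y + y ^ 2 - y * g) + g - y) + y * (g - y)))) + ((s + y + y ^ 2 - y * g) + (1 + y) * (y * n - s)) * ((1 - g) * (((g - y * (g - y)) * (((s + y + y ^ 2 - y * g) + g - y) + y * (g - y))) - ((g - y * (y * n - s)) * (((s + y + y ^ 2 - y * g) + g - y) + y * (y * n - s)))))
          + (1 - g) * y * (1 - y) * (((g - y * (g - y)) * (((s + y + y ^ 2 - y * g) + g - y) + y * (g - y))) - ((g - y * (y * n - s)) * (((s + y + y ^ 2 - y * g) + g - y) + y * (y * n - s)))) := by ring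
    have hKd : 0 ≤ (s + y + y ^ 2 - y * g) + (1 + y) * (y * n - s) := by
      nlinarith only [hy0, hy1, hyg, hg1, hs, h2, mul_nonneg hy0.le hg0.le]
    have hG : 0 ≤ (((s + y + y ^ 2 - y * g) + (1 + y) * (y * n - s)) * (g * (1 - y) * (2 - g) * (s + g) - (1 - g) * ((g - y * (y * n - s)) * (((s + y + y ^ 2 - y * g) + g - y) + y * (y * n - s)))) - (1 - g) * ((g - y * (y * n - s)) * (((s + y + y ^ 2 - y * g) + g - y) + y * (y * n - s))) * y * (1 - y)) := by
      have m1 := mul_nonneg (mul_nonneg (by linarith : (0:ℝ) ≤ 1 + y) hδ0) hB0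
      have m2 := mul_nonneg hKd (mul_nonneg (sub_nonneg.2 hg1) hPi)
      have m3 := mul_nonneg (mul_nonneg (mul_nonneg (sub_nonneg.2 hg1) hy0.le) h1y.le) hPi
      linarith only [emono, m1, m2, m3, hG0]
    -- y · margin = (1 − y) · G(δ)
    have key : y * (g * (n + 1 - (y ^ 2 * (n + 1) + (1 - y) * (s + g))) * ((y ^ 2 * n + (1 - y) * s) - (y ^ 2 * n + (1 - y) * (s + g - 2))) * (s + g) - (1 - g) * ((s + g) - (y ^ 2 * n + (1 - y) * s)) * (n - (y ^ 2 * n + (1 - y) * (s + g - 2))) * (y ^ 2 * (n + 1) + (1 - y) * (s + g))) = (1 - y) * (((s + y + y ^ 2 - y * g) + (1 + y) * (y * n - s)) * (g * (1 - y) * (2 - g) * (s + g) - (1 - g) * ((g - y * (y * n - s)) * (((s + y + y ^ 2 - y * g) + g - y) + y * (y * n - s)))) - (1 - g) * ((g - y * (y * n - s)) * (((s + y + y ^ 2 - y * g) + g - y) + y * (y * n - s))) * y * (1 - y)) := by ring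
    have hpos : 0 ≤ y * (g * (n + 1 - (y ^ 2 * (n + 1) + (1 - y) * (s + g))) * ((y ^ 2 * n + (1 - y) * s) - (y ^ 2 * n + (1 - y) * (s + g - 2))) * (s + g) - (1 - g) * ((s + g) - (y ^ 2 * n + (1 - y) * s)) * (n - (y ^ 2 * n + (1 - y) * (s + g - 2))) * (y ^ 2 * (n + 1) + (1 - y) * (s + g))) := by rw [key]; exact mul_nonneg h1y.le hG
    exact sub_nonneg.1 ((mul_nonneg_iff_of_pos_left hy0).1 hpos)

/-! ### (L1) for the capacities `ψ = 1/pairGate − 1` -/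

/-- bookkeeping: `1/max(c/m, y² + (1−y)(c/m)) = m / max(c, y²m + (1−y)c)` for `m > 0`. [this work] -/
theorem one_div_gateMax_eq (y c m : ℝ) (hm : 0 < m) :
    1 / max (c / m) (y ^ 2 + (1 - y) * (c / m)) = m / max c (y ^ 2 * m + (1 - y) * c) := by
  have e : y ^ 2 + (1 - y) * (c / m) = (y ^ 2 * m + (1 - y) * c) / m := by field_simp
  rw [e, max_div_div_right hm.le, one_div_div]

/-- **INEQUALITY (L1), capacity form** (real parameters; `Q` unclipped — clipping `Q` at `0` only weakens the left side).  `0 < y < 1`, `y ≤ g ≤ 1`,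
`0 < s < n`, `2 < s + g`; with `ψ(ρ) = 1/max(ρ, y² + (1−y)ρ) − 1` and `P = ψ(s/n)`, `Q = ψ((s+g)/n)`, `R = ψ((s+g)/(n+1))`, `S = ψ((s+g−2)/n)`:
`(1−g)·(P − Q)·S ≤ g·R·(S − P)`. [this work] -/
theorem relay_capL1_core (y g s n : ℝ) (hy0 : 0 < y) (hy1 : y < 1) (hyg : y ≤ g) (hg1 : g ≤ 1)
    (hs : 0 < s) (hσ : 2 < s + g) (hsn : s < n) :
    (1 - g) * ((1 / max (s / n) (y ^ 2 + (1 - y) * (s / n)) - 1) - (1 / max ((s + g) / n) (y ^ 2 + (1 - y) * ((s + g) / n)) - 1))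
        * (1 / max ((s + g - 2) / n) (y ^ 2 + (1 - y) * ((s + g - 2) / n)) - 1)
      ≤ g * (1 / max ((s + g) / (n + 1)) (y ^ 2 + (1 - y) * ((s + g) / (n + 1))) - 1)
        * ((1 / max ((s + g - 2) / n) (y ^ 2 + (1 - y) * ((s + g - 2) / n)) - 1)
          - (1 / max (s / n) (y ^ 2 + (1 - y) * (s / n)) - 1)) := by
  have h1y : 0 < 1 - y := by linarith
  have hg0 : 0 < g := lt_of_lt_of_le hy0 hyg
  have hn : 0 < n := lt_trans hs hsn
  have hn1 : 0 < n + 1 := by linarith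
  rw [one_div_gateMax_eq y s n hn, one_div_gateMax_eq y (s + g) n hn, one_div_gateMax_eq y (s + g - 2) n hn,
    one_div_gateMax_eq y (s + g) (n + 1) hn1]
  -- the four denominators are positive
  have hp : 0 < max (s + g - 2) (y ^ 2 * n + (1 - y) * (s + g - 2)) := lt_max_of_lt_left (by linarith)
  have hq : 0 < max s (y ^ 2 * n + (1 - y) * s) := lt_max_of_lt_left hs
  have hr : 0 < max (s + g) (y ^ 2 * n + (1 - y) * (s + g)) := lt_max_of_lt_left (by linarith)
  have hr' : 0 < max (s + g) (y ^ 2 * (n + 1) + (1 - y) * (s + g)) := lt_max_of_lt_left (by linarith)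
  set p := max (s + g - 2) (y ^ 2 * n + (1 - y) * (s + g - 2)) with hpdef
  set q := max s (y ^ 2 * n + (1 - y) * s) with hqdef
  set r := max (s + g) (y ^ 2 * n + (1 - y) * (s + g)) with hrdef
  set r' := max (s + g) (y ^ 2 * (n + 1) + (1 - y) * (s + g)) with hr'def
  have hF := relay_capL1_F y g s n hy0 hy1 hyg hg1 hs hσ hsn
  rw [← hpdef, ← hqdef, ← hrdef, ← hr'def] at hF
  have eL : (1 - g) * (n / q - 1 - (n / r - 1)) * (n / p - 1) = (1 - g) * (r - q) * (n - p) * n / (p * q * r) := by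
    field_simp; ring
  have eR : g * ((n + 1) / r' - 1) * (n / p - 1 - (n / q - 1)) = g * (n + 1 - r') * (q - p) * n / (r' * p * q) := by
    field_simp; ring
  rw [eL, eR, div_le_div_iff₀ (by positivity) (by positivity)]
  -- `(1−g)(r−q)(n−p)·n·(r′pq) ≤ g(n+1−r′)(q−p)·n·(pqr)` from `hF` times `n·p·q > 0`
  have hnpq : 0 < n * (p * q) := by positivity
  nlinarith [mul_le_mul_of_nonneg_left hF hnpq.le]

/-- **INEQUALITY (L1) for `LawDec.pairGate`.**  `0 < y < 1`, `y ≤ g ≤ 1`; a factor low `l` whose successor is a product low (hence `2l < T`)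
(`2(l+1) < T + g`) and a factor atom `a` compatible with `l` at `T` (`T < l + a`).  With the capacities `ψ = 1/pairGate − 1` of the factor pair
`(l, a)` at `T` (`P`) and of the product pairs `(l, a)`, `(l, a+1)`, `(l+1, a+1)` at `T + g` (`Q`, `R`, `S`):  `(1−g)(P − Q)·S ≤ g·R·(S − P)`. [this work] -/
theorem relay_capL1_pairGate (y T g : ℝ) (l a : ℕ) (hy0 : 0 < y) (hy1 : y < 1) (hyg : y ≤ g) (hg1 : g ≤ 1)
    (hsucc : 2 * ((l : ℝ) + 1) < T + g) (hcomp : T < (l : ℝ) + a) :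
    (1 - g) * ((1 / pairGate y T l a - 1) - (1 / pairGate y (T + g) l a - 1)) * (1 / pairGate y (T + g) (l + 1) (a + 1) - 1)
      ≤ g * (1 / pairGate y (T + g) l (a + 1) - 1)
        * ((1 / pairGate y (T + g) (l + 1) (a + 1) - 1) - (1 / pairGate y T l a - 1)) := by
  have key := relay_capL1_core y g (T - 2 * (l : ℝ)) ((a : ℝ) - l) hy0 hy1 hyg hg1 (by linarith) (by linarith) (by linarith)
  have e1 : (T + g - 2 * (l : ℝ)) / ((a : ℝ) - l) = (T - 2 * (l : ℝ) + g) / ((a : ℝ) - l) := by ring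
  have e2 : (T + g - 2 * (l : ℝ)) / (((a + 1 : ℕ) : ℝ) - l) = (T - 2 * (l : ℝ) + g) / ((a : ℝ) - l + 1) := by
    push_cast; ring
  have e3 : (T + g - 2 * ((l + 1 : ℕ) : ℝ)) / (((a + 1 : ℕ) : ℝ) - ((l + 1 : ℕ) : ℝ)) = (T - 2 * (l : ℝ) + g - 2) / ((a : ℝ) - l) := by
    push_cast; ring
  unfold pairGate
  rw [e1, e2, e3]
  exact key

end LawDec

end Quant

end Summit.CriticalPhenomena.PercolationContinuityZ3.Theorems
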